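import Summits.CriticalPhenomena.PercolationContinuityZ3.Theorems.PercNearOneGluingNoHeavyLowerTailSahiThreeCopyPairLiterals

/-!
# `NoHeavyLowerTail` (crux stmt-CriticalPhenomena-4575), Sahi programme: **UNIVERSALLY GOOD PAIRS ARE CLOSED UNDER OR-ADJOINING A
# FRESH LITERAL TO ONE OR BOTH MEMBERS** — `UG(f,g) ⇒ UG(f ∨_{c₁} x₀, g ∨_{c₂} x₀)` for all `c₁, c₂`, third function FREE

Support file (Sahi cell, seat `prim-sahi-p1`, generation 56; `--supports stmt-CriticalPhenomena-4575`).  COMPUTATIONAL only through the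
import of `…PairsClosure` (base `≤ 4` of `UGen`, used in the last corollary); the theorems of this file use standard axioms.  Vocabulary:
`orAdj c f` of `…Literals` (generation 54: `(f ∨_c x₀)(ε,x) = 1` if `c ∧ ε`, else `f(x)`), `UGood` of `…Pairs`, `UGen` of `…PairsClosure`;
companion of `…PairLiterals` (the AND case).

THE QUESTION LEFT OPEN BY `…PairLiterals`: the OR slices contain "reversed Harris" terms, and the numerics of generation 55 showed that the
mixed slices are NOT bounded below by `c_b(f,g,H¹)`.  THE ANSWER (this file): with `H⁰ ≤ H¹` the sections of the free third function,
`η = H¹ − H⁰ ≥ 0`, `f̄ = 1 − f`, `ḡ = 1 − g` and all `N = N_b` on the old coordinates, the four profile entries at the new coordinate are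
EXACTLY (identities, all data real):
* ONE MEMBER `(f, g ∨ x₀)`:
  `k=0`: `c(f,g,H⁰)`;
  `k=1`: `c(f,g,H⁰) + [N(fH¹;1;ḡ) − N(f;H¹;ḡ)] + N(fḡη;1;1) + [N(fgH¹;1;1) − N(fg;H¹;1)] + [N(fgH⁰;1;1) − N(f;gH⁰;1)]`;
  `k=2`: `[N(fH¹;1;ḡ) − N(f;H¹;ḡ)] + N(fḡη;1;1) + [N(fgH¹;1;1) − N(fg;H¹;1)] + [N(fH¹;1;1) − N(f;H¹;1)] + [N(fgH⁰;1;1) − N(f;gH⁰;1)]`;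
  `k=3`: `N(fH¹;1;1) − N(f;H¹;1)`.
  Every bracket is a three-copy Harris gap (`N3_le_N3_mul`, the first one WITH THE SPECTATOR `ḡ = 1 − g ≥ 0`), so the universal-goodness
  hypothesis enters ONLY through `c(f,g,H⁰) ≥ 0`, and the slice `k = 2` needs no hypothesis at all.
* BOTH MEMBERS `(f ∨ x₀, g ∨ x₀)`:
  `k=0`: `c(f,g,H⁰)`;  `k=1`: `c(f,g,H¹) + N(f̄ḡH⁰;1;1) + [N(fgH⁰;1;1) − N(fg;H⁰;1)] + N(ḡη;f̄;1) + N(f̄gη;1;1) + N(f̄η;ḡ;1) + N(fḡη;1;1)`;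
  `k=2`: `N(1−fg;1;η) + [N(fgH⁰;1;1) − N(fg;H⁰;1)] + N(f̄ḡH⁰;1;1)`;  `k=3`: `0`.
Hence ★★ `UGood.orAdj`: for `f, g ≤ 1`, `UG(f,g) ⇒ UG(f ∨_{c₁} x₀, g ∨_{c₂} x₀)`; with `…PairLiterals` and `…PairSubst` the class of universally
good pairs is closed under adjoining fresh literals by `∧` and `∨` to either member and under blockwise monotone substitution — so, e.g.,
`(σ₅ ∨ Φ_A(σ₁,…,σ₄), Φ_B(σ₁,…,σ₄))`, `(σ₅ ∨ Φ_A, σ₅ ∨ Φ_B)`, `(σ₅ ∨ Φ_A, σ₅ ∧ Φ_B)`-type pairs of a FIFTH arbitrary increasing block event are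
universally good (`UGen.orAdj_subst_uGood`): Kahn's inequality holds for them with the third event arbitrary.  The identities were found with
a formal three-copy algebra (memo FROM-prim-sahi-p1-gen56, code/gen56/symn.py); nothing conjectural is used.  [this work]
-/

namespace Summit.CriticalPhenomena.PercolationContinuityZ3.Theorems.SahiThreeCopy

open Finset Function Literature.Combinatorics.Sahi2008
open scoped BigOperators

noncomputable section

variable {d : ℕ}

/-! ### §1 Sections of OR-adjoined functions -/

/-- `(g ∨ x₀)¹ = 1`. [this work] -/
theorem sec_orAdj_true_true (g : Pt d → ℝ) : sec (orAdj true g) true = 1 := by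
  funext x; simp [sec, orAdj, Fin.cons_zero]

/-- `(g ∨ x₀)⁰ = g`. [this work] -/
theorem sec_orAdj_true_false (g : Pt d → ℝ) : sec (orAdj true g) false = g := by
  funext x; simp [sec, orAdj, Fin.cons_zero, Fin.tail_cons]

/-- `(f ∨_{false} x₀)^ε = f` (the lifted function). [this work] -/
theorem sec_orAdj_false (f : Pt d → ℝ) (ε : Bool) : sec (orAdj false f) ε = f := by
  funext x; simp [sec, orAdj, Fin.tail_cons]

/-- `c_b(1,1,h) = 0`. [this work] -/
theorem tc_one_one_left (b : Fin d → ℕ) (h : Pt d → ℝ) : tc b 1 1 h = 0 := by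
  unfold tc
  simp only [one_mul, mul_one]
  rw [N3_comm12 b 1 h 1, N3_comm13 b 1 1 h]
  ring

/-! ### §2 One member: `(f, g ∨ x₀)` against a free `H` -/

/-- ★★ The pair `(f, g ∨ x₀)` (`f` lifted) against a free third function, all profiles, given only `c_b(f,g,H⁰) ≥ 0` (and `f ≥ 0`,
`0 ≤ g ≤ 1`, `H ≥ 0`, all monotone).  The mixed slices are sums of three-copy Harris gaps — one of them with the spectator `1 − g` —
plus `N(f(1−g)(H¹−H⁰);1;1)`; the slice `k = 2` uses no hypothesis on the pair. [this work] -/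
theorem tc_orAdj_right_nonneg (b : Fin (d + 1) → ℕ) {f g : Pt d → ℝ} (hf : ∀ x, 0 ≤ f x) (hfm : Monotone f) (hg : ∀ x, 0 ≤ g x)
    (hg1 : ∀ x, g x ≤ 1) (hgm : Monotone g) {H : Pt (d + 1) → ℝ} (hH : ∀ w, 0 ≤ H w) (hHm : Monotone H)
    (hfg : 0 ≤ tc (Fin.tail b) f g (sec H false)) : 0 ≤ tc b (orAdj false f) (orAdj true g) H := by
  have hb : b = Fin.cons (b 0) (Fin.tail b) := (Fin.cons_self_tail b).symm
  set b' := Fin.tail b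
  have hH0n : ∀ x, 0 ≤ (sec H false) x := sec_nonneg hH false
  have hH1n : ∀ x, 0 ≤ (sec H true) x := sec_nonneg hH true
  have hH0m : Monotone (sec H false) := sec_monotone hHm false
  have hH1m : Monotone (sec H true) := sec_monotone hHm true
  have h01 : ∀ x, (sec H false) x ≤ (sec H true) x := sec_false_le_sec_true hHm
  have hη : ∀ x, 0 ≤ ((sec H true) - (sec H false)) x := fun x => sub_nonneg.2 (h01 x)
  have hgb : ∀ x, 0 ≤ ((1 : Pt d → ℝ) - g) x := fun x => sub_nonneg.2 (hg1 x)
  have hfg0 : ∀ x, 0 ≤ (f * g) x := fun x => mul_nonneg (hf x) (hg x)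
  have hfgm : Monotone (f * g) := hfm.mul hgm hf hg
  have hgH0n : ∀ x, 0 ≤ (g * sec H false) x := fun x => mul_nonneg (hg x) (hH0n x)
  have hgH0m : Monotone (g * sec H false) := hgm.mul hH0m hg hH0n
  have one_nn : ∀ x : Pt d, (0 : ℝ) ≤ (1 : Pt d → ℝ) x := fun _ => zero_le_one
  -- the Harris facts (all profiles `b'`)
  have A1 : N3 b' f (sec H true) (1 - g) ≤ N3 b' (f * sec H true) 1 (1 - g) :=
    N3_le_N3_mul d b' f (sec H true) (1 - g) hf hfm hH1n hH1m hgb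
  have A2 : 0 ≤ N3 b' (f * (1 - g) * (sec H true - sec H false)) 1 1 :=
    N3_nonneg b' (fun x => mul_nonneg (mul_nonneg (hf x) (hgb x)) (hη x)) one_nn one_nn
  have A3 : N3 b' (f * g) (sec H true) 1 ≤ N3 b' (f * g * sec H true) 1 1 :=
    N3_le_N3_mul d b' (f * g) (sec H true) 1 hfg0 hfgm hH1n hH1m one_nn
  have A4 : N3 b' f (g * sec H false) 1 ≤ N3 b' (f * (g * sec H false)) 1 1 :=
    N3_le_N3_mul d b' f (g * sec H false) 1 hf hfm hgH0n hgH0m one_nn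
  have A5 : N3 b' f (sec H true) 1 ≤ N3 b' (f * sec H true) 1 1 :=
    N3_le_N3_mul d b' f (sec H true) 1 hf hfm hH1n hH1m one_nn
  -- bridges between syntactic variants of the same three-copy functional
  have e1 : N3 b' (f * (g * sec H false)) 1 1 = N3 b' (f * g * sec H false) 1 1 := by rw [mul_assoc]
  have e2 : N3 b' f (sec H true) g = N3 b' f g (sec H true) := N3_comm23 b' f (sec H true) g
  have e3 : N3 b' (f * sec H true) 1 g = N3 b' g (f * sec H true) 1 := by rw [N3_comm13, N3_comm23]
  have e4 : N3 b' (f * g) (sec H true) 1 = N3 b' (sec H true) (f * g) 1 := N3_comm12 b' (f * g) (sec H true) 1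
  have e5 : N3 b' 1 (f * sec H false) 1 = N3 b' (f * sec H false) 1 1 := N3_comm12 b' 1 (f * sec H false) 1
  have e6 : N3 b' (sec H false) f 1 = N3 b' f (sec H false) 1 := N3_comm12 b' (sec H false) f 1
  have e7 : N3 b' f 1 (sec H false) = N3 b' f (sec H false) 1 := N3_comm23 b' f 1 (sec H false)
  have e8 : N3 b' 1 (f * sec H true) 1 = N3 b' (f * sec H true) 1 1 := N3_comm12 b' 1 (f * sec H true) 1
  have e9 : N3 b' (sec H true) f 1 = N3 b' f (sec H true) 1 := N3_comm12 b' (sec H true) f 1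
  have e10 : N3 b' f 1 (sec H true) = N3 b' f (sec H true) 1 := N3_comm23 b' f 1 (sec H true)
  simp only [mul_sub, sub_mul, mul_one, N3_sub_left, N3_sub_right] at A1 A2
  rw [hb]
  match hk : b 0 with
  | 0 =>
    rw [tc_cons_zero, sec_orAdj_false, sec_orAdj_true_false]
    exact hfg
  | 1 =>
    rw [tc_cons_one]
    simp only [sec_orAdj_false, sec_orAdj_true_true, sec_orAdj_true_false, sub_self, zero_mul, mul_zero, N3_zero_left,
      N3_zero_mid', add_zero]
    unfold tc at hfg ⊢
    simp only [mul_sub, sub_mul, mul_one, one_mul, N3_sub_left, N3_sub_mid]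
    linarith [hfg, A1, A2, A3, A4, e1, e2, e3, e4, e5, e6, e7]
  | 2 =>
    rw [tc_cons_two]
    simp only [sec_orAdj_false, sec_orAdj_true_true, sec_orAdj_true_false, sub_self, zero_mul, mul_zero, N3_zero_left,
      N3_zero_mid', sub_zero, add_zero]
    unfold tc
    simp only [mul_sub, sub_mul, mul_one, one_mul, N3_sub_left, N3_sub_mid]
    linarith [A1, A2, A3, A4, A5, e1, e2, e3, e4, e5, e6, e7, e8, e9, e10]
  | 3 =>
    rw [tc_cons_three, sec_orAdj_false, sec_orAdj_true_true, tc_comm23]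
    exact tc_one_right_nonneg b' hf hfm hH1n hH1m
  | k + 4 =>
    rw [tc_cons_add_four]

/-! ### §3 Both members: `(f ∨ x₀, g ∨ x₀)` against a free `H` -/

/-- ★★ The pair `(f ∨ x₀, g ∨ x₀)` against a free third function, all profiles, given `c_b(f,g,H⁰) ≥ 0` and `c_b(f,g,H¹) ≥ 0`
(and `0 ≤ f, g ≤ 1`, `H ≥ 0`, all monotone); the slice `k = 2` uses no hypothesis on the pair and the slice `k = 3` vanishes. [this work] -/
theorem tc_orAdj_both_nonneg (b : Fin (d + 1) → ℕ) {f g : Pt d → ℝ} (hf : ∀ x, 0 ≤ f x) (hf1 : ∀ x, f x ≤ 1) (hfm : Monotone f)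
    (hg : ∀ x, 0 ≤ g x) (hg1 : ∀ x, g x ≤ 1) (hgm : Monotone g) {H : Pt (d + 1) → ℝ} (hH : ∀ w, 0 ≤ H w) (hHm : Monotone H)
    (hfg0 : 0 ≤ tc (Fin.tail b) f g (sec H false)) (hfg1 : 0 ≤ tc (Fin.tail b) f g (sec H true)) :
    0 ≤ tc b (orAdj true f) (orAdj true g) H := by
  have hb : b = Fin.cons (b 0) (Fin.tail b) := (Fin.cons_self_tail b).symm
  set b' := Fin.tail b
  have hH0n : ∀ x, 0 ≤ (sec H false) x := sec_nonneg hH false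
  have hH1n : ∀ x, 0 ≤ (sec H true) x := sec_nonneg hH true
  have hH0m : Monotone (sec H false) := sec_monotone hHm false
  have h01 : ∀ x, (sec H false) x ≤ (sec H true) x := sec_false_le_sec_true hHm
  have hη : ∀ x, 0 ≤ ((sec H true) - (sec H false)) x := fun x => sub_nonneg.2 (h01 x)
  have hfb : ∀ x, 0 ≤ ((1 : Pt d → ℝ) - f) x := fun x => sub_nonneg.2 (hf1 x)
  have hgb : ∀ x, 0 ≤ ((1 : Pt d → ℝ) - g) x := fun x => sub_nonneg.2 (hg1 x)
  have hfg0' : ∀ x, 0 ≤ (f * g) x := fun x => mul_nonneg (hf x) (hg x)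
  have hfgm : Monotone (f * g) := hfm.mul hgm hf hg
  have hfgb : ∀ x, 0 ≤ ((1 : Pt d → ℝ) - f * g) x := by
    intro x
    simp only [Pi.sub_apply, Pi.mul_apply, Pi.one_apply]
    nlinarith [hf x, hg x, hf1 x, hg1 x]
  have one_nn : ∀ x : Pt d, (0 : ℝ) ≤ (1 : Pt d → ℝ) x := fun _ => zero_le_one
  -- the facts
  have B1 : 0 ≤ N3 b' ((1 - f) * (1 - g) * sec H false) 1 1 :=
    N3_nonneg b' (fun x => mul_nonneg (mul_nonneg (hfb x) (hgb x)) (hH0n x)) one_nn one_nn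
  have B2 : N3 b' (f * g) (sec H false) 1 ≤ N3 b' (f * g * sec H false) 1 1 :=
    N3_le_N3_mul d b' (f * g) (sec H false) 1 hfg0' hfgm hH0n hH0m one_nn
  have B3 : 0 ≤ N3 b' ((1 - g) * (sec H true - sec H false)) (1 - f) 1 :=
    N3_nonneg b' (fun x => mul_nonneg (hgb x) (hη x)) hfb one_nn
  have B4 : 0 ≤ N3 b' ((1 - f) * g * (sec H true - sec H false)) 1 1 :=
    N3_nonneg b' (fun x => mul_nonneg (mul_nonneg (hfb x) (hg x)) (hη x)) one_nn one_nn
  have B5 : 0 ≤ N3 b' ((1 - f) * (sec H true - sec H false)) (1 - g) 1 :=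
    N3_nonneg b' (fun x => mul_nonneg (hfb x) (hη x)) hgb one_nn
  have B6 : 0 ≤ N3 b' (f * (1 - g) * (sec H true - sec H false)) 1 1 :=
    N3_nonneg b' (fun x => mul_nonneg (mul_nonneg (hf x) (hgb x)) (hη x)) one_nn one_nn
  have B7 : 0 ≤ N3 b' (1 - f * g) 1 (sec H true - sec H false) := N3_nonneg b' hfgb one_nn hη
  -- bridges
  have e1 : N3 b' (sec H false) g 1 = N3 b' g (sec H false) 1 := N3_comm12 b' (sec H false) g 1
  have e2 : N3 b' (sec H false) f 1 = N3 b' f (sec H false) 1 := N3_comm12 b' (sec H false) f 1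
  have e3 : N3 b' (sec H false) (f * g) 1 = N3 b' (f * g) (sec H false) 1 := N3_comm12 b' (sec H false) (f * g) 1
  have e4 : N3 b' (sec H true) f 1 = N3 b' f (sec H true) 1 := N3_comm12 b' (sec H true) f 1
  have e5 : N3 b' (g * sec H true) f 1 = N3 b' f (g * sec H true) 1 := N3_comm12 b' (g * sec H true) f 1
  have e6 : N3 b' (g * sec H false) f 1 = N3 b' f (g * sec H false) 1 := N3_comm12 b' (g * sec H false) f 1
  have e7 : N3 b' (sec H true) g 1 = N3 b' g (sec H true) 1 := N3_comm12 b' (sec H true) g 1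
  have e8 : N3 b' (f * sec H true) g 1 = N3 b' g (f * sec H true) 1 := N3_comm12 b' (f * sec H true) g 1
  have e9 : N3 b' (f * sec H false) g 1 = N3 b' g (f * sec H false) 1 := N3_comm12 b' (f * sec H false) g 1
  have e10 : N3 b' 1 1 (sec H true) = N3 b' (sec H true) 1 1 := N3_comm13 b' 1 1 (sec H true)
  have e11 : N3 b' 1 1 (sec H false) = N3 b' (sec H false) 1 1 := N3_comm13 b' 1 1 (sec H false)
  have e12 : N3 b' (f * g) 1 (sec H true) = N3 b' (sec H true) (f * g) 1 := by rw [N3_comm23, N3_comm12]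
  have e13 : N3 b' (f * g) 1 (sec H false) = N3 b' (f * g) (sec H false) 1 := N3_comm23 b' (f * g) 1 (sec H false)
  have e14 : N3 b' 1 (g * sec H false) 1 = N3 b' (g * sec H false) 1 1 := N3_comm12 b' 1 (g * sec H false) 1
  have e15 : N3 b' g 1 (sec H false) = N3 b' g (sec H false) 1 := N3_comm23 b' g 1 (sec H false)
  have e16 : N3 b' 1 (f * sec H false) 1 = N3 b' (f * sec H false) 1 1 := N3_comm12 b' 1 (f * sec H false) 1
  have e17 : N3 b' f 1 (sec H false) = N3 b' f (sec H false) 1 := N3_comm23 b' f 1 (sec H false)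
  have e18 : N3 b' 1 (f * sec H true) 1 = N3 b' (f * sec H true) 1 1 := N3_comm12 b' 1 (f * sec H true) 1
  have e19 : N3 b' f 1 (sec H true) = N3 b' f (sec H true) 1 := N3_comm23 b' f 1 (sec H true)
  have e20 : N3 b' 1 (g * sec H true) 1 = N3 b' (g * sec H true) 1 1 := N3_comm12 b' 1 (g * sec H true) 1
  have e21 : N3 b' g 1 (sec H true) = N3 b' g (sec H true) 1 := N3_comm23 b' g 1 (sec H true)
  have e22 : N3 b' 1 g (sec H true) = N3 b' g (sec H true) 1 := by rw [N3_comm12, N3_comm23]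
  have e23 : N3 b' (sec H true) (f * g) 1 = N3 b' (f * g) (sec H true) 1 := N3_comm12 b' (sec H true) (f * g) 1
  have e24 : N3 b' (sec H false) 1 1 = N3 b' 1 (sec H false) 1 := N3_comm12 b' (sec H false) 1 1
  have e25 : N3 b' (sec H true) 1 1 = N3 b' 1 (sec H true) 1 := N3_comm12 b' (sec H true) 1 1
  have z11 : tc b' 1 1 (sec H false) = 0 := tc_one_one_left b' (sec H false)
  simp only [mul_sub, sub_mul, mul_one, one_mul, N3_sub_left, N3_sub_mid, N3_sub_right] at B1 B3 B4 B5 B6 B7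
  rw [hb]
  match hk : b 0 with
  | 0 =>
    rw [tc_cons_zero, sec_orAdj_true_false, sec_orAdj_true_false]
    exact hfg0
  | 1 =>
    rw [tc_cons_one]
    simp only [sec_orAdj_true_true, sec_orAdj_true_false]
    rw [tc_comm12 b' 1 g (sec H false), tc_comm23 b' g 1 (sec H false), tc_one_right, tc_comm23 b' f 1 (sec H false),
      tc_one_right]
    simp only [mul_sub, sub_mul, mul_one, one_mul, N3_sub_left, N3_sub_mid]
    linarith [hfg1, B1, B2, B3, B4, B5, B6, e1, e2, e3, e4, e5, e6, e7, e8, e9, e10, e11, e12, e13, e14, e15, e16, e17, e18, e19,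
      e20, e21, e22, e23, e24, e25]
  | 2 =>
    rw [tc_cons_two]
    simp only [sec_orAdj_true_true, sec_orAdj_true_false]
    rw [z11, tc_comm23 b' f 1 (sec H true), tc_one_right, tc_comm12 b' 1 g (sec H true), tc_comm23 b' g 1 (sec H true),
      tc_one_right]
    simp only [mul_sub, sub_mul, mul_one, one_mul, N3_sub_left, N3_sub_mid]
    linarith [B1, B2, B7, e1, e2, e3, e4, e5, e6, e7, e8, e9, e10, e11, e12, e13, e14, e15, e16, e17, e18, e19, e20, e21, e22,
      e23, e24, e25]
  | 3 =>
    rw [tc_cons_three, sec_orAdj_true_true, sec_orAdj_true_true, tc_one_one_left]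
  | k + 4 =>
    rw [tc_cons_add_four]

/-! ### §4 Universally good pairs and OR-literals -/

/-- ★★ **Universally good pairs (with values in `[0,1]`) are closed under OR-adjoining a fresh literal to one or both members** (third
function free). [this work] -/
theorem UGood.orAdj {f g : Pt d → ℝ} (h : UGood f g) (hf1 : ∀ x, f x ≤ 1) (hg1 : ∀ x, g x ≤ 1) (c₁ c₂ : Bool) :
    UGood (SahiThreeCopy.orAdj c₁ f) (SahiThreeCopy.orAdj c₂ g) := by
  obtain ⟨hf, hg, hfm, hgm, htc⟩ := h
  refine ⟨orAdj_nonneg c₁ hf, orAdj_nonneg c₂ hg, orAdj_monotone c₁ hf1 hfm, orAdj_monotone c₂ hg1 hgm, fun b H hH hHm => ?_⟩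
  have hfgF : 0 ≤ tc (Fin.tail b) f g (sec H false) := htc _ _ (sec_nonneg hH false) (sec_monotone hHm false)
  have hfgT : 0 ≤ tc (Fin.tail b) f g (sec H true) := htc _ _ (sec_nonneg hH true) (sec_monotone hHm true)
  have hgfF : 0 ≤ tc (Fin.tail b) g f (sec H false) := by rw [tc_comm12]; exact hfgF
  cases c₁ <;> cases c₂
  · -- both lifted: `orAdj false f = liftB 1 f`
    have e1 : SahiThreeCopy.orAdj false f = SahiThreeCopy.liftB 1 f := by funext w; simp [SahiThreeCopy.orAdj, SahiThreeCopy.liftB]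
    have e2 : SahiThreeCopy.orAdj false g = SahiThreeCopy.liftB 1 g := by funext w; simp [SahiThreeCopy.orAdj, SahiThreeCopy.liftB]
    rw [e1, e2]
    have hug : UGood f g := ⟨hf, hg, hfm, hgm, htc⟩
    exact (hug.liftB 1).2.2.2.2 b H hH hHm
  · exact tc_orAdj_right_nonneg b hf hfm hg hg1 hgm hH hHm hfgF
  · rw [tc_comm12]; exact tc_orAdj_right_nonneg b hg hgm hf hf1 hfm hH hHm hgfF
  · exact tc_orAdj_both_nonneg b hf hf1 hfm hg hg1 hgm hH hHm hfgF hfgT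

/-- Composite step: OR-adjoin one fresh literal (to either member or both), then AND-adjoin a second fresh literal (`…PairLiterals`);
universal goodness is preserved. [this work] -/
theorem UGood.orAdj_andAdj {f g : Pt d → ℝ} (h : UGood f g) (hf1 : ∀ x, f x ≤ 1) (hg1 : ∀ x, g x ≤ 1) (c₁ c₂ c₃ c₄ : Bool) :
    UGood (SahiThreeCopy.andAdj c₃ (SahiThreeCopy.orAdj c₁ f)) (SahiThreeCopy.andAdj c₄ (SahiThreeCopy.orAdj c₂ g)) :=
  (h.orAdj hf1 hg1 c₁ c₂).andAdj c₃ c₄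

/-- Hence every `[0,1]`-valued pair of the generated class `UGen` stays universally good after OR-adjoining fresh literals (and, by
`UGood.subst`, after substituting the literal by an arbitrary monotone block function): e.g. `(σ₅ ∨ Φ_A(σ₁,…,σ₄), σ₅ ∨ Φ_B(σ₁,…,σ₄))` and
`(Φ_A(σ₁,…,σ₄), σ₅ ∨ Φ_B(σ₁,…,σ₄))` with a FIFTH block event `σ₅`. [this work] -/
theorem UGen.orAdj_subst_uGood {f g : Pt d → ℝ} (h : UGen d f g) (hf1 : ∀ x, f x ≤ 1) (hg1 : ∀ x, g x ≤ 1) (c₁ c₂ : Bool) (e : ℕ)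
    {σ : Pt e → Bool} (hσ : Monotone σ) :
    UGood (SahiThreeCopy.subst e σ (SahiThreeCopy.orAdj c₁ f)) (SahiThreeCopy.subst e σ (SahiThreeCopy.orAdj c₂ g)) :=
  (h.uGood.orAdj hf1 hg1 c₁ c₂).subst e hσ

end

end Summit.CriticalPhenomena.PercolationContinuityZ3.Theorems.SahiThreeCopy
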